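/-
Copyright (c) 2026 the pub-hodgecm-mathlib formalisation cell (harness21).  Prover seat hodgecm-mathlib-K2E3-p23 (g4), Track B «K2-LIT» ∕ h413
(`stmt-HodgeConjecture-24833`), line `K2_E3_EllipticInputs`, (SC-an) road «FC» (line lead K2E3-p14 (g4), RULINGS #15∕#18), brick (FC-8) file F1.  2026-09-04.
-/
import Literature.NumberTheory.Automorphic.UnitaryGroupRankOneCartanAnyInvolution   -- ★ Cartan `U = ⋃ K₀ aⁿ K₀ Z(U)`, the ray `d(ϖ,1,(σϖ)⁻¹)`, `exists_inv_pow_eq`, `mem_glInt_iff_forall_v_le_one`, `inv_apply_of_mem`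
import Literature.NumberTheory.Automorphic.HyperspecialUnitaryCompactOpen            -- ★ `isOpen_unitaryInt`, `isCompact_unitaryInt_of_forall_v_eq`; brings ★ `SymplecticCartan.exists_forall_v_le_exp_of_isCompact`
import Literature.NumberTheory.Automorphic.LocalUnitaryGroupCenter                   -- ★ `exists_coe_eq_scalar_of_mem_center_unitaryGroupOfForm`
import HarnessLib

/-!
# Crux `H413` — K2-LIT E3, (SC-an) road «FC» (finite conjugation measure), brick (FC-8) file F1: THE `K₀ A K₀` ADAPTER ON `U = U(σ, Φ₃)(K)` —
# `U = ⋃ₙ K₀ · tₙ · K₀` with `K₀ = U ∩ GL₃(𝒪)` compact open and `tₙ = d(ϖ⁻ⁿ, 1, (σϖ)ⁿ)`, the entries of `tₙ h tₙ⁻¹`, and the `K₀`-bi-invariant compact boxes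

Cell `hodgecm-mathlib`, Track B, line `K2_E3_EllipticInputs`, socket U12 :255 (SC-an) via road «FC» of K2E3-p14 (g4) (RULINGS #15 (R15-1) steps (i)–(ii), RULINGS #18
(R18-1): «FC-8 the model assembly»); seat K2E3-p23 (g4).  THEOREMS ONLY (no `def`, no `instance`, no notation, no named-fact hypothesis, no `sorry`); count-neutral
helper (`--supports stmt-HodgeConjecture-24833 --as helper`).  First of three files of (FC-8): the pieces of the assembly that need NO pending brick.

THE MATHEMATICS.  `K` a field with `Valued K ℤᵐ⁰` (+ `ValuativeRel`, compatible), `σ` an isometric involution, `J = Φ₃` (`(StdForm.antidiagonal 3).over K`),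
`U = unitaryGroupOfForm σ J`, `K₀ = unitaryInt σ J = U ∩ GL₃(𝒪)` (★ `HermitianLattice.unitaryInt`; open ★ `isOpen_unitaryInt`, compact ★
`isCompact_unitaryInt_of_forall_v_eq`), `a = d(ϖ, 1, (σϖ)⁻¹) ∈ U` the torus ray of ★ `UnitaryGroupRankOneCartanAnyInvolution` (`ϖ` a uniformiser).
* §1 `comap_glInt_eq_unitaryInt` — the `K₀` of ★ `exists_cartan_of_involution` (`(glInt 3 K).comap U.subtype`) IS `unitaryInt σ J`;
  `center_le_unitaryInt` — `Z(U) ≤ K₀` (central ⇒ scalar `u·1` ★, `σ(u)u = 1` from the `(0,2)` entry of `Φ₃`, so `|u| = 1`).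
* §2 `coe_inv_pow_eq_diagonal` — `tₙ := (aⁿ)⁻¹ = d(ϖ⁻ⁿ, 1, (σϖ)ⁿ)`; **`exists_mem_doubleCoset_inv_pow`** — **`U = ⋃ₙ K₀ tₙ K₀`** (★ Cartan + ★ `exists_inv_pow_eq` + §1);
  the INVERSE ray is the one for which `tₙ h tₙ⁻¹ ∈ Ω` makes the UPPER entries of `h` small (FC-6b's `h01 h12 h02`).
* §3 `conj_inv_pow_apply` — `(tₙ h tₙ⁻¹)ᵢⱼ = tᵢ hᵢⱼ tⱼ⁻¹`; `conj_inv_pow_apply_diag` — the diagonal is unchanged; **`v_upper_le_of_conj_inv_pow`** —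
  `v((tₙhtₙ⁻¹)ᵢⱼ) ≤ exp M ⇒ v(h₀₁), v(h₁₂) ≤ exp(M − n)`, `v(h₀₂) ≤ exp(M − 2n)`.
* §4 (generic topological group `G`, compact open subgroup `K₀`, compact `S₀`) the BOX `Ω = K₀ · S₀ · K₀`: compact (`isCompact_box`), `S₀ ⊆ Ω` (`subset_box`),
  `K₀`-bi-invariant (`mul_mem_box_iff`, `mem_box_mul_iff`), covered by finitely many left `K₀`-cosets (`exists_finset_box_subset_biUnion_smul`); and on `U`:
  **`exists_forall_mem_v_apply_le_exp`** — the entries of a compact subset of `U` are bounded by some `exp M` (★ `exists_forall_v_le_exp_of_isCompact`).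

HONEST LABEL: HC_CM is proved only modulo the 7 printed citations (2 remaining named inputs: hLiu418 = stmt-HodgeConjecture-24832, h413 =
stmt-HodgeConjecture-24833) until rung 0 closes; local structure theory, closes no organ by itself ((SC-an) is NOT ★; road «FC» pays `hballE` only when all its
bricks land).

## References
* [BruhatTits1972] F. Bruhat, J. Tits, *Groupes réductifs sur un corps local I*, Publ. Math. IHÉS 41 (1972), (4.4.3) (`G = K A⁺ K`).
* [Tits1979] J. Tits, *Reductive groups over local fields*, Proc. Sympos. Pure Math. 33.1 (1979), §3.2 (compact open stabilisers), §3.3.3 (Cartan decomposition).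
* [Rogawski1990] J. D. Rogawski, *Automorphic Representations of Unitary Groups in Three Variables*, Ann. of Math. Stud. 123 (1990), §1.9–§1.10 pp. 8–9.
* [PlatonovRapinchuk1994] V. Platonov, A. Rapinchuk, *Algebraic Groups and Number Theory* (1994), §2.3 (centre of the unitary group), §3.3.
* [HarishChandra1970] Harish-Chandra (notes by G. van Dijk), *Harmonic Analysis on Reductive p-adic Groups*, LNM 162 (1970), Part V §3 (the integral over `K A K`).
-/

set_option autoImplicit false
-- the mandated namespace repeats `HodgeConjecture.HodgeConjecture`, as in every `Theorems/*.lean` of this sub-problem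
set_option linter.dupNamespace false

noncomputable section

open scoped MatrixGroups Pointwise Topology WithZero Valued
open Matrix Set

namespace Summit.HodgeConjecture.HodgeConjecture.Cruxes.H413.K2E3FinConjCartanCover

open Literature.NumberTheory.Automorphic Literature.NumberTheory.Automorphic.UnitaryGroup Literature.NumberTheory.Automorphic.HermitianLattice
open Literature.NumberTheory.Automorphic.SymplecticCartan

/-! ## §1 `K₀ = U ∩ GL₃(𝒪)`: the two spellings agree; the centre is inside -/

section KZero

variable {K : Type*} [Field K] [Valued K ℤᵐ⁰] [ValuativeRel K] [(Valued.v : Valuation K ℤᵐ⁰).Compatible]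
  (σ : K →+* K) {J : Matrix (Fin 3) (Fin 3) K} (hJ : J = (StdForm.antidiagonal 3).over K)

include hJ in
/-- **The `K₀` of ★ `exists_cartan_of_involution` is `unitaryInt σ J`**: `(glInt 3 K).comap U.subtype = U ∩ GL₃(𝒪)` (for `g ∈ U(σ,Φ₃)` the inverse is
`Φ₃ σ(g)ᵀ Φ₃`, so integrality of `g` gives that of `g⁻¹`, ★ `inv_apply_of_mem`). [cite: PlatonovRapinchuk1994, §3.3] [cite: Tits1979, §3.2] -/
theorem comap_glInt_eq_unitaryInt (hσv : ∀ x, Valued.v (σ x) = Valued.v x) :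
    (glInt 3 K).comap (unitaryGroupOfForm σ J).subtype = unitaryInt σ J := by
  ext g
  rw [Subgroup.mem_comap, Subgroup.coe_subtype, mem_glInt_iff_forall_v_le_one σ hJ hσv g, mem_unitaryInt_iff]
  constructor
  · intro h
    refine ⟨h, fun i j => ?_⟩
    rw [inv_apply_of_mem σ hJ g i j, hσv]
    exact h _ _
  · exact fun h => h.1

include hJ in
/-- **`Z(U) ≤ K₀`**: a central element of `U(σ, Φ₃)(K)` is a scalar `u·1` (★ `exists_coe_eq_scalar_of_mem_center_unitaryGroupOfForm`, `2, 3 ≠ 0`), the `(0,2)` entry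
of `σ(u·1)ᵀ Φ₃ (u·1) = Φ₃` reads `σ(u) u = 1`, so `|u| = 1` (`|σu| = |u|`) and `u·1 ∈ GL₃(𝒪)`. [cite: PlatonovRapinchuk1994, §2.3] -/
theorem center_le_unitaryInt (hσ : ∀ x, σ (σ x) = x) (hσv : ∀ x, Valued.v (σ x) = Valued.v x) (h2 : (2 : K) ≠ 0) (h3 : (3 : K) ≠ 0) :
    Subgroup.center ↥(unitaryGroupOfForm σ J) ≤ unitaryInt σ J := by
  intro z hz
  have hH : (J.map σ)ᵀ = J := by rw [hJ, StdForm.over_map, StdForm.transpose_over]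
  have hHd : J.det ≠ 0 := by rw [hJ]; exact ((Matrix.isUnit_iff_isUnit_det _).1 ((StdForm.antidiagonal 3).isUnit_over _)).ne_zero
  have h02 : J 0 2 = 1 := by
    rw [hJ]; simp [StdForm.over, StdForm.antidiagonal]
  obtain ⟨u, hu⟩ := exists_coe_eq_scalar_of_mem_center_unitaryGroupOfForm σ J hσ hH hHd h2 h3 hz
  -- the matrix of `z` is `diagonal (fun _ => u)`
  have hmat : ((z : GL (Fin 3) K) : Matrix (Fin 3) (Fin 3) K) = Matrix.diagonal fun _ => (u : K) := by
    rw [hu, Matrix.GeneralLinearGroup.coe_scalar, Matrix.scalar_apply]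
  -- unitarity at the `(0,2)` entry: `σ(u) u = 1`
  have hzU := mem_unitaryGroupOfForm_iff.1 z.2
  have hentry := congrFun (congrFun hzU 0) 2
  rw [hmat, Matrix.diagonal_map (map_zero σ), Matrix.diagonal_transpose, Matrix.mul_diagonal, Matrix.diagonal_mul, h02, mul_one] at hentry
  -- hence `|u| = 1`
  have hprod : Valued.v (u : K) * Valued.v (u : K) = 1 := by
    have := congrArg Valued.v hentry
    rwa [map_mul, hσv, map_one] at this
  have hvu : Valued.v (u : K) = 1 := by
    rcases lt_trichotomy (Valued.v (u : K)) 1 with hlt | heq | hgt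
    · exfalso
      have hx0 : Valued.v (u : K) ≠ 0 := (Valuation.ne_zero_iff _).2 u.ne_zero
      have : Valued.v (u : K) * Valued.v (u : K) < 1 :=
        calc Valued.v (u : K) * Valued.v (u : K) < Valued.v (u : K) * 1 := mul_lt_mul_of_pos_left hlt (zero_lt_iff.2 hx0)
          _ ≤ 1 * 1 := mul_le_mul' hlt.le le_rfl
          _ = 1 := mul_one 1
      rw [hprod] at this; exact lt_irrefl _ this
    · exact heq
    · exfalso
      have : 1 < Valued.v (u : K) * Valued.v (u : K) :=
        calc (1 : ℤᵐ⁰) = 1 * 1 := (mul_one 1).symm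
          _ < Valued.v (u : K) * 1 := mul_lt_mul_of_pos_right hgt zero_lt_one
          _ ≤ Valued.v (u : K) * Valued.v (u : K) := mul_le_mul' le_rfl hgt.le
      rw [hprod] at this; exact lt_irrefl _ this
  -- so `z ∈ GL₃(𝒪)`
  rw [← comap_glInt_eq_unitaryInt σ hJ hσv, Subgroup.mem_comap, Subgroup.coe_subtype]
  refine mem_glInt_of_coe_eq σ hJ hσv hmat fun i j => ?_
  rw [Matrix.diagonal_apply]
  split_ifs
  · exact hvu.le
  · rw [map_zero]; exact zero_le

end KZero

/-! ## §2 The inverse ray `tₙ = (aⁿ)⁻¹ = d(ϖ⁻ⁿ, 1, (σϖ)ⁿ)` and the cover `U = ⋃ₙ K₀ tₙ K₀` -/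

section Ray

variable {K : Type*} [Field K] [Valued K ℤᵐ⁰] [ValuativeRel K] [(Valued.v : Valuation K ℤᵐ⁰).Compatible]
  (σ : K →+* K) {J : Matrix (Fin 3) (Fin 3) K} (hJ : J = (StdForm.antidiagonal 3).over K) {ϖ : K}

include hJ in
omit [Valued K ℤᵐ⁰] [ValuativeRel K] [(Valued.v : Valuation K ℤᵐ⁰).Compatible] in
/-- **`tₙ = (aⁿ)⁻¹` has matrix `d(ϖ⁻ⁿ, 1, (σϖ)ⁿ)`** (★ `coe_pow_eq_diagonal` + ★ `inv_apply_of_mem`: the inverse in `U(σ,Φ₃)` is `σ` of the `rev`-transpose).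
[cite: Rogawski1990, §1.10 p. 9] -/
theorem coe_inv_pow_eq_diagonal (hσ : ∀ x, σ (σ x) = x) (a : ↥(unitaryGroupOfForm σ J))
    (ha : ((a : GL (Fin 3) K) : Matrix (Fin 3) (Fin 3) K) = Matrix.diagonal ![ϖ, 1, (σ ϖ)⁻¹]) (n : ℕ) :
    ((((a ^ n)⁻¹ : ↥(unitaryGroupOfForm σ J)) : GL (Fin 3) K) : Matrix (Fin 3) (Fin 3) K) = Matrix.diagonal ![ϖ⁻¹ ^ n, 1, (σ ϖ) ^ n] := by
  ext i j
  rw [Subgroup.coe_inv, inv_apply_of_mem σ hJ (a ^ n) i j, coe_pow_eq_diagonal σ a ha n]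
  fin_cases i <;> fin_cases j <;> simp [Fin.rev, map_pow, hσ]

include hJ in
/-- **THE COVER `U = ⋃ₙ K₀ · tₙ · K₀`**, `tₙ = (aⁿ)⁻¹`, `K₀ = unitaryInt σ J`: every `g ∈ U(σ, Φ₃)(K)` lies in `K₀ (aⁿ)⁻¹ K₀` for some `n : ℕ` (★ Cartan
`g = k₁ aⁿ k₂ z`, the centre is in `K₀` by `center_le_unitaryInt`, and `aⁿ = k₄⁻¹ (aⁿ)⁻¹ k₃⁻¹ ∈ K₀ (aⁿ)⁻¹ K₀` by ★ `exists_inv_pow_eq`; `σ` an isometric involution, `ϖ` a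
uniformiser, `2, 3 ≠ 0`). [cite: BruhatTits1972, (4.4.3)] [cite: Tits1979, §3.3.3] -/
theorem exists_mem_doubleCoset_inv_pow (hσ : ∀ x, σ (σ x) = x) (hσv : ∀ x, Valued.v (σ x) = Valued.v x)
    (hϖ : Valued.v ϖ = WithZero.exp (-1 : ℤ)) (h2 : (2 : K) ≠ 0) (h3 : (3 : K) ≠ 0)
    (a : ↥(unitaryGroupOfForm σ J)) (ha : ((a : GL (Fin 3) K) : Matrix (Fin 3) (Fin 3) K) = Matrix.diagonal ![ϖ, 1, (σ ϖ)⁻¹])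
    (g : ↥(unitaryGroupOfForm σ J)) :
    ∃ n : ℕ, g ∈ (unitaryInt σ J : Set ↥(unitaryGroupOfForm σ J)) * {(a ^ n)⁻¹} * (unitaryInt σ J : Set ↥(unitaryGroupOfForm σ J)) := by
  have hϖ0 : ϖ ≠ 0 := fun h => by rw [h, map_zero] at hϖ; exact WithZero.zero_ne_coe hϖ
  obtain ⟨k₁, hk₁, k₂, hk₂, n, z, hz, hg⟩ := exists_cartan_of_involution σ hJ hσ hσv hϖ a ha g
  obtain ⟨k₃, hk₃, k₄, hk₄, hinv⟩ := exists_inv_pow_eq σ hJ hσ hσv hϖ0 a ha n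
  rw [comap_glInt_eq_unitaryInt σ hJ hσv] at hk₁ hk₂ hk₃ hk₄
  have hzK : z ∈ unitaryInt σ J := center_le_unitaryInt σ hJ hσ hσv h2 h3 hz
  -- `aⁿ = k₄⁻¹ (aⁿ)⁻¹ k₃⁻¹`
  have hpow : a ^ n = k₄⁻¹ * (a ^ n)⁻¹ * k₃⁻¹ := by
    have : (a ^ n)⁻¹⁻¹ = (k₃ * a ^ n * k₄)⁻¹ := by rw [hinv]
    rw [inv_inv, _root_.mul_inv_rev, _root_.mul_inv_rev, ← mul_assoc] at this
    exact this
  refine ⟨n, Set.mem_mul.2 ⟨k₁ * k₄⁻¹ * (a ^ n)⁻¹, Set.mem_mul.2 ⟨k₁ * k₄⁻¹, (unitaryInt σ J).mul_mem hk₁ ((unitaryInt σ J).inv_mem hk₄), (a ^ n)⁻¹,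
    Set.mem_singleton _, rfl⟩, k₃⁻¹ * k₂ * z, (unitaryInt σ J).mul_mem ((unitaryInt σ J).mul_mem ((unitaryInt σ J).inv_mem hk₃) hk₂) hzK, ?_⟩⟩
  symm
  calc g = k₁ * a ^ n * k₂ * z := hg
    _ = k₁ * (k₄⁻¹ * (a ^ n)⁻¹ * k₃⁻¹) * k₂ * z := by rw [← hpow]
    _ = k₁ * k₄⁻¹ * (a ^ n)⁻¹ * (k₃⁻¹ * k₂ * z) := by simp only [mul_assoc]

end Ray

/-! ## §3 Conjugation by `tₙ`: entries, diagonal, and the smallness of the upper entries -/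

section Conj

variable {K : Type*} [Field K] [Valued K ℤᵐ⁰] [ValuativeRel K] [(Valued.v : Valuation K ℤᵐ⁰).Compatible]
  (σ : K →+* K) {J : Matrix (Fin 3) (Fin 3) K} (hJ : J = (StdForm.antidiagonal 3).over K) {ϖ : K}

include hJ in
omit [Valued K ℤᵐ⁰] [ValuativeRel K] [(Valued.v : Valuation K ℤᵐ⁰).Compatible] in
/-- **`(tₙ h tₙ⁻¹)ᵢⱼ = tᵢ · hᵢⱼ · tⱼ⁻¹`** with `t = d(ϖ⁻ⁿ, 1, (σϖ)ⁿ)`, `t⁻¹ = aⁿ = d(ϖⁿ, 1, (σϖ)⁻ⁿ)`. [cite: Rogawski1990, §1.10 p. 9] -/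
theorem conj_inv_pow_apply (hσ : ∀ x, σ (σ x) = x) (a : ↥(unitaryGroupOfForm σ J))
    (ha : ((a : GL (Fin 3) K) : Matrix (Fin 3) (Fin 3) K) = Matrix.diagonal ![ϖ, 1, (σ ϖ)⁻¹]) (n : ℕ) (h : ↥(unitaryGroupOfForm σ J)) (i j : Fin 3) :
    ((((a ^ n)⁻¹ * h * a ^ n : ↥(unitaryGroupOfForm σ J)) : GL (Fin 3) K) : Matrix (Fin 3) (Fin 3) K) i j =
      ![ϖ⁻¹ ^ n, 1, (σ ϖ) ^ n] i * ((h : GL (Fin 3) K) : Matrix (Fin 3) (Fin 3) K) i j * ![ϖ ^ n, 1, (σ ϖ)⁻¹ ^ n] j := by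
  rw [Subgroup.coe_mul, Subgroup.coe_mul, Units.val_mul, Units.val_mul, coe_inv_pow_eq_diagonal σ hJ hσ a ha n, coe_pow_eq_diagonal σ a ha n,
    Matrix.mul_diagonal, Matrix.diagonal_mul]

include hJ in
omit [Valued K ℤᵐ⁰] [ValuativeRel K] [(Valued.v : Valuation K ℤᵐ⁰).Compatible] in
/-- **The diagonal of `tₙ h tₙ⁻¹` is the diagonal of `h`** (`ϖ ≠ 0`). [cite: Rogawski1990, §1.10 p. 9] -/
theorem conj_inv_pow_apply_diag (hσ : ∀ x, σ (σ x) = x) (hϖ0 : ϖ ≠ 0) (a : ↥(unitaryGroupOfForm σ J))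
    (ha : ((a : GL (Fin 3) K) : Matrix (Fin 3) (Fin 3) K) = Matrix.diagonal ![ϖ, 1, (σ ϖ)⁻¹]) (n : ℕ) (h : ↥(unitaryGroupOfForm σ J)) (i : Fin 3) :
    ((((a ^ n)⁻¹ * h * a ^ n : ↥(unitaryGroupOfForm σ J)) : GL (Fin 3) K) : Matrix (Fin 3) (Fin 3) K) i i =
      ((h : GL (Fin 3) K) : Matrix (Fin 3) (Fin 3) K) i i := by
  have hσϖ0 : σ ϖ ≠ 0 := (map_ne_zero σ).2 hϖ0
  rw [conj_inv_pow_apply σ hJ hσ a ha n h i i]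
  fin_cases i
  · simp only [Fin.zero_eta, Matrix.cons_val_zero]
    rw [mul_comm, ← mul_assoc, ← mul_pow, mul_inv_cancel₀ hϖ0, one_pow, one_mul]
  · simp
  · simp only [Fin.reduceFinMk, Matrix.cons_val]
    rw [mul_comm, ← mul_assoc, ← mul_pow, inv_mul_cancel₀ hσϖ0, one_pow, one_mul]

include hJ in
omit [ValuativeRel K] [(Valued.v : Valuation K ℤᵐ⁰).Compatible] in
/-- **SMALL UPPER ENTRIES**: if every entry of `tₙ h tₙ⁻¹` has valuation `≤ exp M` then `v(h₀₁), v(h₁₂) ≤ exp(M − n)` and `v(h₀₂) ≤ exp(M − 2n)` (`σ` an isometric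
involution, `ϖ` a uniformiser) — the binders `h01 h12 h02` of the lead's (FC-6b). [cite: HarishChandra1970, Part V §3] [cite: Rogawski1990, §1.10 p. 9] -/
theorem v_upper_le_of_conj_inv_pow (hσ : ∀ x, σ (σ x) = x) (hσv : ∀ x, Valued.v (σ x) = Valued.v x) (hϖ : Valued.v ϖ = WithZero.exp (-1 : ℤ))
    (a : ↥(unitaryGroupOfForm σ J)) (ha : ((a : GL (Fin 3) K) : Matrix (Fin 3) (Fin 3) K) = Matrix.diagonal ![ϖ, 1, (σ ϖ)⁻¹]) (n M : ℕ)
    (h : ↥(unitaryGroupOfForm σ J))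
    (hb : ∀ i j, Valued.v (((((a ^ n)⁻¹ * h * a ^ n : ↥(unitaryGroupOfForm σ J)) : GL (Fin 3) K) : Matrix (Fin 3) (Fin 3) K) i j) ≤ WithZero.exp (M : ℤ)) :
    Valued.v (((h : GL (Fin 3) K) : Matrix (Fin 3) (Fin 3) K) 0 1) ≤ WithZero.exp ((M : ℤ) - n) ∧
      Valued.v (((h : GL (Fin 3) K) : Matrix (Fin 3) (Fin 3) K) 1 2) ≤ WithZero.exp ((M : ℤ) - n) ∧
        Valued.v (((h : GL (Fin 3) K) : Matrix (Fin 3) (Fin 3) K) 0 2) ≤ WithZero.exp ((M : ℤ) - 2 * n) := by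
  have hvinv : Valued.v (ϖ⁻¹ ^ n) = WithZero.exp (n : ℤ) := by
    rw [map_pow, map_inv₀, hϖ, ← WithZero.exp_neg, neg_neg, ← WithZero.exp_nsmul, nsmul_eq_mul, mul_one]
  have hvσ : Valued.v ((σ ϖ)⁻¹ ^ n) = WithZero.exp (n : ℤ) := by
    rw [map_pow, map_inv₀, hσv, hϖ, ← WithZero.exp_neg, neg_neg, ← WithZero.exp_nsmul, nsmul_eq_mul, mul_one]
  -- generic step: `exp n * v x ≤ exp M ⇒ v x ≤ exp (M - n)`, and the `2n` twin
  have key : ∀ (x : K) (e : ℤ), WithZero.exp e * Valued.v x ≤ WithZero.exp (M : ℤ) → Valued.v x ≤ WithZero.exp ((M : ℤ) - e) := by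
    intro x e hx
    calc Valued.v x = WithZero.exp (-e) * (WithZero.exp e * Valued.v x) := by
          rw [← mul_assoc, ← WithZero.exp_add, neg_add_cancel, WithZero.exp_zero, one_mul]
      _ ≤ WithZero.exp (-e) * WithZero.exp (M : ℤ) := mul_le_mul' le_rfl hx
      _ = WithZero.exp ((M : ℤ) - e) := by rw [← WithZero.exp_add, neg_add_eq_sub]
  have h01 := hb 0 1
  have h12 := hb 1 2
  have h02 := hb 0 2
  rw [conj_inv_pow_apply σ hJ hσ a ha n h] at h01 h12 h02
  simp only [Fin.isValue, Matrix.cons_val_zero, Matrix.cons_val_one, Matrix.cons_val, mul_one, one_mul, map_mul, hvinv, hvσ] at h01 h12 h02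
  refine ⟨key _ _ h01, key _ _ ?_, key _ _ ?_⟩
  · rwa [mul_comm] at h12
  · rw [mul_right_comm, ← WithZero.exp_add, ← two_mul] at h02
    exact h02

end Conj

/-! ## §4 Boxes: `Ω = K₀ · S₀ · K₀` (generic topological group) and the entry bound on `U` -/

section Box

variable {G : Type*} [Group G] [TopologicalSpace G] [IsTopologicalGroup G] (K₀ : Subgroup G)

/-- **`Ω = K₀ S₀ K₀` is compact** for `K₀`, `S₀` compact. [folklore] -/
theorem isCompact_box (hK : IsCompact (K₀ : Set G)) {S₀ : Set G} (hS : IsCompact S₀) : IsCompact ((K₀ : Set G) * S₀ * (K₀ : Set G)) :=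
  (hK.mul hS).mul hK

omit [TopologicalSpace G] [IsTopologicalGroup G] in
/-- **`S₀ ⊆ K₀ S₀ K₀`**. [folklore] -/
theorem subset_box (S₀ : Set G) : S₀ ⊆ (K₀ : Set G) * S₀ * (K₀ : Set G) := fun s hs =>
  Set.mem_mul.2 ⟨1 * s, Set.mem_mul.2 ⟨1, K₀.one_mem, s, hs, rfl⟩, 1, K₀.one_mem, by rw [one_mul, mul_one]⟩

omit [TopologicalSpace G] [IsTopologicalGroup G] in
/-- **Left `K₀`-invariance of the box**: `k g ∈ Ω ↔ g ∈ Ω` (`k ∈ K₀`). [folklore] -/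
theorem mul_mem_box_iff (S₀ : Set G) {k : G} (hk : k ∈ K₀) (g : G) :
    k * g ∈ (K₀ : Set G) * S₀ * (K₀ : Set G) ↔ g ∈ (K₀ : Set G) * S₀ * (K₀ : Set G) := by
  have aux : ∀ {k : G}, k ∈ K₀ → ∀ g : G, g ∈ (K₀ : Set G) * S₀ * (K₀ : Set G) → k * g ∈ (K₀ : Set G) * S₀ * (K₀ : Set G) := by
    intro k hk g hg
    obtain ⟨x, hx, y, hy, rfl⟩ := Set.mem_mul.1 hg
    obtain ⟨k₁, hk₁, s, hs, rfl⟩ := Set.mem_mul.1 hx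
    exact Set.mem_mul.2 ⟨k * k₁ * s, Set.mem_mul.2 ⟨k * k₁, K₀.mul_mem hk hk₁, s, hs, rfl⟩, y, hy, by rw [mul_assoc, mul_assoc, mul_assoc]⟩
  refine ⟨fun h => ?_, aux hk g⟩
  have := aux (K₀.inv_mem hk) _ h
  rwa [inv_mul_cancel_left] at this

omit [TopologicalSpace G] [IsTopologicalGroup G] in
/-- **Right `K₀`-invariance of the box**: `g k ∈ Ω ↔ g ∈ Ω` (`k ∈ K₀`). [folklore] -/
theorem mem_box_mul_iff (S₀ : Set G) {k : G} (hk : k ∈ K₀) (g : G) :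
    g * k ∈ (K₀ : Set G) * S₀ * (K₀ : Set G) ↔ g ∈ (K₀ : Set G) * S₀ * (K₀ : Set G) := by
  have aux : ∀ {k : G}, k ∈ K₀ → ∀ g : G, g ∈ (K₀ : Set G) * S₀ * (K₀ : Set G) → g * k ∈ (K₀ : Set G) * S₀ * (K₀ : Set G) := by
    intro k hk g hg
    obtain ⟨x, hx, y, hy, rfl⟩ := Set.mem_mul.1 hg
    exact Set.mem_mul.2 ⟨x, hx, y * k, K₀.mul_mem hy hk, by rw [mul_assoc]⟩
  refine ⟨fun h => ?_, aux hk g⟩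
  have := aux (K₀.inv_mem hk) _ h
  rwa [mul_inv_cancel_right] at this

/-- **A compact set is covered by finitely many left cosets of an open subgroup.** [folklore] -/
theorem exists_finset_subset_biUnion_smul (hKo : IsOpen (K₀ : Set G)) {Ω : Set G} (hΩ : IsCompact Ω) :
    ∃ F : Finset G, Ω ⊆ ⋃ f ∈ F, f • (K₀ : Set G) := by
  refine hΩ.elim_finite_subcover (fun f : G => f • (K₀ : Set G)) (fun f => hKo.smul f) fun x _ => ?_
  exact Set.mem_iUnion.2 ⟨x, ⟨1, K₀.one_mem, mul_one x⟩⟩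

end Box

section Entries

variable {K : Type*} [Field K] [Valued K ℤᵐ⁰] (σ : K →+* K) (J : Matrix (Fin 3) (Fin 3) K) {ϖ : K}

/-- **The entries of a compact subset of `U` are bounded**: `∃ M, ∀ g ∈ Ω, ∀ i j, v(gᵢⱼ) ≤ exp M` (each entry is continuous; ★ `exists_forall_v_le_exp_of_isCompact`; the
maximum over the nine entries). [cite: Tits1979, §3.2] -/
theorem exists_forall_mem_v_apply_le_exp (hϖ : Valued.v ϖ = WithZero.exp (-1 : ℤ)) {Ω : Set ↥(unitaryGroupOfForm σ J)} (hΩ : IsCompact Ω) :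
    ∃ M : ℕ, ∀ g ∈ Ω, ∀ i j, Valued.v (((g : GL (Fin 3) K) : Matrix (Fin 3) (Fin 3) K) i j) ≤ WithZero.exp (M : ℤ) := by
  have hcont : ∀ i j : Fin 3, Continuous fun g : ↥(unitaryGroupOfForm σ J) => ((g : GL (Fin 3) K) : Matrix (Fin 3) (Fin 3) K) i j :=
    fun i j => (Units.continuous_val.comp continuous_subtype_val).matrix_elem i j
  choose M hM using fun ij : Fin 3 × Fin 3 => exists_forall_v_le_exp_of_isCompact hϖ (hΩ.image (hcont ij.1 ij.2))
  refine ⟨Finset.univ.sup M, fun g hg i j => ?_⟩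
  refine (hM (i, j) _ ⟨g, hg, rfl⟩).trans (WithZero.exp_le_exp.2 ?_)
  exact_mod_cast Finset.le_sup (f := M) (Finset.mem_univ (i, j))

end Entries

end Summit.HodgeConjecture.HodgeConjecture.Cruxes.H413.K2E3FinConjCartanCover

end
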